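import Literature.NumberTheory.Automorphic.AutomorphicQuotientDiagonalTrace
import Literature.NumberTheory.Automorphic.IntegratedOperatorStar
import HarnessLib

/-!
# Polarisation: the diagonal trace on the convolution span, `θ(g ⋆ h^*) = Tr(R(g) R(h)^*)`
(Gelbart, *Automorphic forms on adele groups* (1975), (9.11): "`tr R(f) = ∫ K(x, x) dx` … at least when `f` is of the form
`f₁ * f₂`", Lemma 10.6; Rogawski (1990), §14.5: "`T_{G′}(f′)` is the trace of `ρ(f′)` on `L(G′)`"; Deitmar–Echterhoff (2014),
Prop. 6.2.1 (`π(f₁ * f₂) = π(f₁) π(f₂)`, `π(f^*) = π(f)^*`))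

Topic `NumberTheory/Automorphic`; namespace `Literature.NumberTheory.Automorphic` (dot notation on `AdelicGroupData`, grouping
sub-namespace `UnitaryGroup`). THEOREMS ONLY (no definition, no named fact, no instance or instance attribute). Continuation of
`AutomorphicQuotientDiagonalTrace`: there the NAMED functional `θ = 𝒢.diagTrace μ ρ ν` was shown to satisfy
`θ(f ⋆ f^*) = Σ_i ‖R(f) e_i‖²` (`hasSum_norm_sq_eq_diagTrace`), i.e. `θ` is the Hilbert–Schmidt trace on the CONE `{f ⋆ f^*}`. By
POLARISATION and the `ℂ`-linearity of `θ` this extends to the convolution SPAN `{g ⋆ h^*}`: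

* `mulStar_add`, `mulStar_smul`, `mulConv_add_left`, `mulConv_add_right`, `mulConv_smul_left`, `mulConv_smul_right` — `(g, h) ↦ g ⋆ h^*`
  is sesquilinear on `C_c(G)` (linear in `g`, conjugate-linear in `h`);
* `mulConv_mulStar_add_smul` — `(g + c h) ⋆ (g + c h)^* = g ⋆ g^* + c̄ · g ⋆ h^* + c · h ⋆ g^* + |c|² · h ⋆ h^*`;
* `mulConv_mulStar_polarization` — **`4 · g ⋆ h^* = Σ_{c ∈ {1, −1, i, −i}} c · (g + c h) ⋆ (g + c h)^*`**;
* `AdelicGroupData.diagTrace_hasSum_inner` — for an adelic group datum with compact automorphic quotient (hypotheses of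
  `hasSum_norm_sq_eq_diagTrace`), `g, h ∈ C_c(G(𝔸_K), ℂ)`, `F ∈ C_c` agreeing pointwise with `g ⋆ h^*` and every countable Hilbert
  basis `(e_i)` of `L²(X, μ)`: **`Σ_i ⟪R(h) e_i, R(g) e_i⟫ = θ(F)`** — Mathlib's inner product is conjugate-linear in the FIRST slot, so
  for `g = h` this is `Σ_i ‖R(g) e_i‖² = θ(g ⋆ g^*)`, clause (i) of the line; in operator terms `θ(g ⋆ h^*) = Tr(R(h)^* R(g)) =
  Tr(R(g) R(h)^*)`, the literal trace of `R(g ⋆ h^*) = R(g) R(h)^*` — print's "`tr R(f′)`" for every `f′` in the convolution span;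
* `UnitaryGroup.diagTrace_hasSum_inner` — the same for `θ_{G′} = UnitaryGroup.diagTrace L N H μ ν hanis`, `G′ = U(H)` anisotropic.

NOT here: Dixmier–Malliavin (`C_c^∞ = span C_c^∞ ⋆ C_c^∞`), which would extend `θ = Tr R(·)` to all smooth test functions.

## References

* S. Gelbart, *Automorphic forms on adele groups*, Ann. of Math. Studies 83 (1975), (9.11), Lemma 10.6 [Gelbart1975].
* A. Deitmar, S. Echterhoff, *Principles of Harmonic Analysis*, 2nd ed. (2014), Prop. 6.2.1 [DeitmarEchterhoff2014].
* J. Rogawski, *Automorphic Representations of Unitary Groups in Three Variables* (1990), §14.5 (print p. 237) [Rogawski1990].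
-/

noncomputable section

open MeasureTheory Measure Set Filter Topology CompactlySupported NumberField
open Literature.MeasureTheory.Group
open scoped ENNReal NNReal InnerProductSpace ComplexConjugate

namespace Literature.NumberTheory.Automorphic

/-! ### `(g, h) ↦ g ⋆ h^*` is sesquilinear on `C_c(G)` -/

section Sesquilinear

variable {G : Type*} [Group G] {𝕜 : Type*} [RCLike 𝕜]

/-- `(f + g)^* = f^* + g^*`. [cite: DeitmarEchterhoff2014, Prop. 6.2.1] -/
theorem mulStar_add (f g : G → 𝕜) : mulStar (f + g) = mulStar f + mulStar g := by
  funext x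
  simp only [mulStar_apply, Pi.add_apply, map_add]

/-- `(c f)^* = c̄ f^*`. [cite: DeitmarEchterhoff2014, Prop. 6.2.1] -/
theorem mulStar_smul (c : 𝕜) (f : G → 𝕜) : mulStar (c • f) = (starRingEnd 𝕜 c) • mulStar f := by
  funext x
  simp only [mulStar_apply, Pi.smul_apply, smul_eq_mul, map_mul]

variable [MeasurableSpace G] (ν : Measure G)

/-- `(c f) ⋆ h = c (f ⋆ h)`. [cite: DeitmarEchterhoff2014, Prop. 6.2.1] -/
theorem mulConv_smul_left (c : 𝕜) (f h : G → 𝕜) : mulConv ν (c • f) h = c • mulConv ν f h := by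
  funext x
  simp only [mulConv_apply, Pi.smul_apply, smul_eq_mul, mul_assoc]
  exact integral_const_mul c _

/-- `f ⋆ (c h) = c (f ⋆ h)`. [cite: DeitmarEchterhoff2014, Prop. 6.2.1] -/
theorem mulConv_smul_right (c : 𝕜) (f h : G → 𝕜) : mulConv ν f (c • h) = c • mulConv ν f h := by
  funext x
  simp only [mulConv_apply, Pi.smul_apply, smul_eq_mul]
  rw [← integral_const_mul]
  refine integral_congr_ae (Eventually.of_forall fun u => ?_)
  change f u * (c * h (u⁻¹ * x)) = c * (f u * h (u⁻¹ * x))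
  ring

variable [TopologicalSpace G] [IsTopologicalGroup G] [BorelSpace G] [IsFiniteMeasureOnCompacts ν]

/-- The convolution integrand `u ↦ f(u) h(u⁻¹ x)` is integrable for `f ∈ C_c(G)` and `h` continuous.
[cite: DeitmarEchterhoff2014, Prop. 6.2.1] -/
private theorem integrable_mul_comp_inv_mul {f h : G → 𝕜} (hf : Continuous f) (hfs : HasCompactSupport f)
    (hh : Continuous h) (x : G) : Integrable (fun u => f u * h (u⁻¹ * x)) ν :=
  (hf.mul (hh.comp (continuous_inv.mul continuous_const))).integrable_of_hasCompactSupport hfs.mul_right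

/-- `(f₁ + f₂) ⋆ h = f₁ ⋆ h + f₂ ⋆ h` for `f₁, f₂ ∈ C_c(G)` and `h` continuous. [cite: DeitmarEchterhoff2014, Prop. 6.2.1] -/
theorem mulConv_add_left {f₁ f₂ h : G → 𝕜} (hf₁ : Continuous f₁) (hfs₁ : HasCompactSupport f₁) (hf₂ : Continuous f₂)
    (hfs₂ : HasCompactSupport f₂) (hh : Continuous h) : mulConv ν (f₁ + f₂) h = mulConv ν f₁ h + mulConv ν f₂ h := by
  funext x
  simp only [mulConv_apply, Pi.add_apply, add_mul]
  exact integral_add (integrable_mul_comp_inv_mul ν hf₁ hfs₁ hh x) (integrable_mul_comp_inv_mul ν hf₂ hfs₂ hh x)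

/-- `f ⋆ (h₁ + h₂) = f ⋆ h₁ + f ⋆ h₂` for `f ∈ C_c(G)` and `h₁, h₂` continuous. [cite: DeitmarEchterhoff2014, Prop. 6.2.1] -/
theorem mulConv_add_right {f h₁ h₂ : G → 𝕜} (hf : Continuous f) (hfs : HasCompactSupport f) (hh₁ : Continuous h₁)
    (hh₂ : Continuous h₂) : mulConv ν f (h₁ + h₂) = mulConv ν f h₁ + mulConv ν f h₂ := by
  funext x
  simp only [mulConv_apply, Pi.add_apply, mul_add]
  exact integral_add (integrable_mul_comp_inv_mul ν hf hfs hh₁ x) (integrable_mul_comp_inv_mul ν hf hfs hh₂ x)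

/-- **Binomial expansion on the convolution algebra**: for `g, h ∈ C_c(G, ℂ)` and `c ∈ ℂ`,
`(g + c h) ⋆ (g + c h)^* = g ⋆ g^* + c̄ · g ⋆ h^* + c · h ⋆ g^* + (c c̄) · h ⋆ h^*`. [cite: Gelbart1975, Lemma 10.6] -/
theorem mulConv_mulStar_add_smul (g h : C_c(G, ℂ)) (c : ℂ) :
    mulConv ν (⇑(g + c • h)) (mulStar ⇑(g + c • h)) =
      mulConv ν (⇑g) (mulStar ⇑g) + (starRingEnd ℂ c) • mulConv ν (⇑g) (mulStar ⇑h)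
        + c • mulConv ν (⇑h) (mulStar ⇑g) + (c * starRingEnd ℂ c) • mulConv ν (⇑h) (mulStar ⇑h) := by
  have hg : Continuous (⇑g) := g.continuous
  have hgs : HasCompactSupport (⇑g) := g.hasCompactSupport
  have hh : Continuous (⇑h) := h.continuous
  have hhs : HasCompactSupport (⇑h) := h.hasCompactSupport
  have hch : Continuous (c • ⇑h) := hh.const_smul c
  have hchs : HasCompactSupport (c • ⇑h) := hhs.smul_left
  have hgst : Continuous (mulStar ⇑g) := continuous_mulStar hg
  have hhst : Continuous (mulStar ⇑h) := continuous_mulStar hh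
  have hchst : Continuous ((starRingEnd ℂ c) • mulStar ⇑h) := hhst.const_smul _
  rw [CompactlySupportedContinuousMap.coe_add, CompactlySupportedContinuousMap.coe_smul, mulStar_add, mulStar_smul,
    mulConv_add_left ν hg hgs hch hchs (hgst.add hchst), mulConv_add_right ν hg hgs hgst hchst,
    mulConv_add_right ν hch hchs hgst hchst, mulConv_smul_right, mulConv_smul_left, mulConv_smul_left,
    mulConv_smul_right, smul_smul]
  abel

/-- **Polarisation on the convolution algebra**: for `g, h ∈ C_c(G, ℂ)`,
`4 · g ⋆ h^* = (g + h) ⋆ (g + h)^* − (g − h) ⋆ (g − h)^* + i · (g + i h) ⋆ (g + i h)^* − i · (g − i h) ⋆ (g − i h)^*`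
(written with `g + c • h`, `c = 1, −1, i, −i`). [cite: Gelbart1975, Lemma 10.6] -/
theorem mulConv_mulStar_polarization (g h : C_c(G, ℂ)) :
    (4 : ℂ) • mulConv ν (⇑g) (mulStar ⇑h) =
      mulConv ν (⇑(g + (1 : ℂ) • h)) (mulStar ⇑(g + (1 : ℂ) • h))
        - mulConv ν (⇑(g + (-1 : ℂ) • h)) (mulStar ⇑(g + (-1 : ℂ) • h))
        + Complex.I • mulConv ν (⇑(g + Complex.I • h)) (mulStar ⇑(g + Complex.I • h))
        - Complex.I • mulConv ν (⇑(g + (-Complex.I) • h)) (mulStar ⇑(g + (-Complex.I) • h)) := by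
  rw [mulConv_mulStar_add_smul, mulConv_mulStar_add_smul, mulConv_mulStar_add_smul, mulConv_mulStar_add_smul]
  funext x
  simp only [Pi.add_apply, Pi.sub_apply, Pi.smul_apply, smul_eq_mul, map_one, map_neg, Complex.conj_I]
  linear_combination (2 * mulConv ν (⇑g) (mulStar ⇑h) x - 2 * mulConv ν (⇑h) (mulStar ⇑g) x) * Complex.I_sq

end Sesquilinear

/-! ### Polarisation in a complex inner product space (the norm form used here) -/

section Hilbert

variable {E : Type*} [NormedAddCommGroup E] [InnerProductSpace ℂ E]

/-- `⟪x, y⟫ = ¼ (‖y + x‖² − ‖y − x‖² + i ‖y + i x‖² − i ‖y − i x‖²)` (Mathlib's inner product is conjugate-linear in the first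
slot; written with `y + c • x`, `c = 1, −1, i, −i`; Mathlib `inner_eq_sum_norm_sq_div_four` rearranged). [cite: Gelbart1975, Lemma 10.6] -/
theorem inner_eq_norm_sq_polarization (x y : E) :
    ⟪x, y⟫_ℂ = (4 : ℂ)⁻¹ * ((((‖y + (1 : ℂ) • x‖ ^ 2 : ℝ) : ℂ)) - (((‖y + (-1 : ℂ) • x‖ ^ 2 : ℝ) : ℂ))
      + Complex.I * (((‖y + Complex.I • x‖ ^ 2 : ℝ) : ℂ)) - Complex.I * (((‖y + (-Complex.I) • x‖ ^ 2 : ℝ) : ℂ))) := by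
  have hI : (RCLike.I : ℂ) = Complex.I := rfl
  have e1 : ‖y + (1 : ℂ) • x‖ = ‖x + y‖ := by rw [one_smul, add_comm]
  have e2 : ‖y + (-1 : ℂ) • x‖ = ‖x - y‖ := by rw [neg_one_smul, ← sub_eq_add_neg, norm_sub_rev]
  have e3 : ‖y + Complex.I • x‖ = ‖x - Complex.I • y‖ := by
    have e : x - Complex.I • y = (-Complex.I) • (y + Complex.I • x) := by
      rw [smul_add, smul_smul, show -Complex.I * Complex.I = 1 by rw [neg_mul, Complex.I_mul_I, neg_neg], one_smul,
        neg_smul, sub_eq_add_neg]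
      abel
    rw [e, norm_smul, norm_neg, Complex.norm_I, one_mul]
  have e4 : ‖y + (-Complex.I) • x‖ = ‖x + Complex.I • y‖ := by
    have e : x + Complex.I • y = Complex.I • (y + (-Complex.I) • x) := by
      rw [smul_add, smul_smul, show Complex.I * -Complex.I = 1 by rw [mul_neg, Complex.I_mul_I, neg_neg], one_smul]
      abel
    rw [e, norm_smul, Complex.norm_I, one_mul]
  have hofReal : ∀ r : ℝ, (RCLike.ofReal r : ℂ) = (r : ℂ) := fun r => rfl
  rw [e1, e2, e3, e4, inner_eq_sum_norm_sq_div_four, hI]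
  simp only [hofReal]
  push_cast
  ring

end Hilbert

/-! ### The diagonal trace on the convolution span -/

namespace AdelicGroupData

universe u

variable {K : Type} [Field K] [NumberField K] (𝒢 : AdelicGroupData.{u} K)
  (μ : Measure 𝒢.automorphicQuotient) [𝒢.IsAutomorphicMeasure μ]
  [LocallyCompactSpace 𝒢.Adelic] [SecondCountableTopology 𝒢.Adelic] [T2Space 𝒢.Adelic]
  [MeasurableSpace 𝒢.Adelic] [BorelSpace 𝒢.Adelic]
  [hH : IsClosed (𝒢.quotientSubgroup : Set 𝒢.Adelic)]
  (ρ : Measure 𝒢.quotientSubgroup) [ρ.IsMulLeftInvariant] [ρ.IsMulRightInvariant] [ρ.IsInvInvariant]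
  [IsFiniteMeasureOnCompacts ρ] [SFinite ρ]
  (ν : Measure 𝒢.Adelic) [IsHaarMeasure ν] [ν.IsInvInvariant]

/-- **`θ(g ⋆ h^*) = Σ_i ⟪R(h) e_i, R(g) e_i⟫ = Tr(R(g) R(h)^*)`** on a compact automorphic quotient. For `g, h ∈ C_c(G(𝔸_K), ℂ)`, every
`F ∈ C_c` agreeing pointwise with `g ⋆ h^*` and every countable Hilbert basis `(e_i)` of `L²(X, μ)`, the series `Σ_i ⟪R(h) e_i, R(g) e_i⟫`
converges to `θ(F) = 𝒢.diagTrace μ ρ ν F` (inner product conjugate-linear in the first slot; `g = h` is `hasSum_norm_sq_eq_diagTrace`).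
Proof: polarisation `4 g ⋆ h^* = Σ_c c (g + ch) ⋆ (g + ch)^*` over `c ∈ {1, −1, i, −i}` (`mulConv_mulStar_polarization`), linearity of
`θ`, the cone identity for each `g + c h`, linearity of `f ↦ R(f)` (`integratedOperator_add/_smul`) and the Hilbert-space polarisation
`inner_eq_norm_sq_polarization`. [cite: Gelbart1975, (9.11) and Lemma 10.6] [cite: Rogawski1990, §14.5 p. 237] -/
theorem diagTrace_hasSum_inner [CompactSpace 𝒢.automorphicQuotient] (hρ : ρ ≠ 0) (g h F : C_c(𝒢.Adelic, ℂ))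
    (hF : ∀ x, F x = mulConv ν (⇑g) (mulStar (⇑h)) x) {ι : Type*} [Countable ι] (b : HilbertBasis ι ℂ (𝒢.L2 μ)) :
    HasSum (fun i => ⟪(𝒢.rightRegular μ).integratedOperator (𝒢.isUnitary_rightRegular μ)
        (𝒢.isStronglyContinuous_rightRegular_holds μ) ν h (b i),
      (𝒢.rightRegular μ).integratedOperator (𝒢.isUnitary_rightRegular μ)
        (𝒢.isStronglyContinuous_rightRegular_holds μ) ν g (b i)⟫_ℂ) (𝒢.diagTrace μ ρ ν F) := by
  have hu := 𝒢.isUnitary_rightRegular μ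
  have hc := 𝒢.isStronglyContinuous_rightRegular_holds μ
  -- the cone identity for the four functions `g + c h`
  have hsq : ∀ c : ℂ, ∃ Fc : C_c(𝒢.Adelic, ℂ), (∀ x, Fc x = mulConv ν (⇑(g + c • h)) (mulStar ⇑(g + c • h)) x) ∧
      HasSum (fun i => (((‖(𝒢.rightRegular μ).integratedOperator hu hc ν g (b i) +
        c • (𝒢.rightRegular μ).integratedOperator hu hc ν h (b i)‖ ^ 2 : ℝ) : ℂ))) (𝒢.diagTrace μ ρ ν Fc) := by
    intro c
    obtain ⟨Fc, hFc⟩ := exists_mulConv_mulStar_eq ν (g + c • h)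
    refine ⟨Fc, hFc, ?_⟩
    have h1 := 𝒢.hasSum_norm_sq_eq_diagTrace μ ρ ν hρ (g + c • h) Fc hFc b
    have e : ∀ i, (𝒢.rightRegular μ).integratedOperator hu hc ν (g + c • h) (b i) =
        (𝒢.rightRegular μ).integratedOperator hu hc ν g (b i) + c • (𝒢.rightRegular μ).integratedOperator hu hc ν h (b i) := by
      intro i
      rw [ContRepresentation.integratedOperator_add, ContRepresentation.integratedOperator_smul]
      rfl
    simp only [e] at h1
    exact h1
  obtain ⟨F₁, hF₁, h₁⟩ := hsq 1
  obtain ⟨F₂, hF₂, h₂⟩ := hsq (-1)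
  obtain ⟨F₃, hF₃, h₃⟩ := hsq Complex.I
  obtain ⟨F₄, hF₄, h₄⟩ := hsq (-Complex.I)
  -- `F = ¼ (F₁ - F₂ + i F₃ - i F₄)` in `C_c`
  have hFcomb : F = (4 : ℂ)⁻¹ • (F₁ - F₂ + Complex.I • F₃ - Complex.I • F₄) := by
    ext x
    have hp := congrFun (mulConv_mulStar_polarization ν g h) x
    simp only [Pi.smul_apply, Pi.add_apply, Pi.sub_apply, smul_eq_mul] at hp
    rw [CompactlySupportedContinuousMap.coe_smul, CompactlySupportedContinuousMap.coe_sub,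
      CompactlySupportedContinuousMap.coe_add, CompactlySupportedContinuousMap.coe_sub,
      CompactlySupportedContinuousMap.coe_smul, CompactlySupportedContinuousMap.coe_smul]
    simp only [Pi.smul_apply, Pi.add_apply, Pi.sub_apply, smul_eq_mul]
    rw [hF x, hF₁ x, hF₂ x, hF₃ x, hF₄ x]
    linear_combination (4 : ℂ)⁻¹ * hp
  have hθ : 𝒢.diagTrace μ ρ ν F = (4 : ℂ)⁻¹ * (𝒢.diagTrace μ ρ ν F₁ - 𝒢.diagTrace μ ρ ν F₂ +
      Complex.I * 𝒢.diagTrace μ ρ ν F₃ - Complex.I * 𝒢.diagTrace μ ρ ν F₄) := by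
    rw [hFcomb, map_smul, map_sub, map_add, map_sub, map_smul, map_smul, smul_eq_mul, smul_eq_mul, smul_eq_mul]
  -- combine the four series
  have hsum := ((h₁.sub h₂).add ((h₃.mul_left Complex.I).sub (h₄.mul_left Complex.I))).mul_left (4 : ℂ)⁻¹
  have hval : 𝒢.diagTrace μ ρ ν F = (4 : ℂ)⁻¹ * ((𝒢.diagTrace μ ρ ν F₁ - 𝒢.diagTrace μ ρ ν F₂) +
      (Complex.I * 𝒢.diagTrace μ ρ ν F₃ - Complex.I * 𝒢.diagTrace μ ρ ν F₄)) := by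
    rw [hθ]; ring
  have hfun : (fun i => ⟪(𝒢.rightRegular μ).integratedOperator hu hc ν h (b i),
      (𝒢.rightRegular μ).integratedOperator hu hc ν g (b i)⟫_ℂ) = fun i => (4 : ℂ)⁻¹ *
      ((((‖(𝒢.rightRegular μ).integratedOperator hu hc ν g (b i) +
          (1 : ℂ) • (𝒢.rightRegular μ).integratedOperator hu hc ν h (b i)‖ ^ 2 : ℝ) : ℂ) -
        ((‖(𝒢.rightRegular μ).integratedOperator hu hc ν g (b i) +
          (-1 : ℂ) • (𝒢.rightRegular μ).integratedOperator hu hc ν h (b i)‖ ^ 2 : ℝ) : ℂ)) +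
      (Complex.I * ((‖(𝒢.rightRegular μ).integratedOperator hu hc ν g (b i) +
          Complex.I • (𝒢.rightRegular μ).integratedOperator hu hc ν h (b i)‖ ^ 2 : ℝ) : ℂ) -
        Complex.I * ((‖(𝒢.rightRegular μ).integratedOperator hu hc ν g (b i) +
          (-Complex.I) • (𝒢.rightRegular μ).integratedOperator hu hc ν h (b i)‖ ^ 2 : ℝ) : ℂ))) := by
    funext i
    rw [inner_eq_norm_sq_polarization]
    ring
  rw [hval, hfun]
  exact hsum

end AdelicGroupData

/-! ### The unitary group of an anisotropic hermitian matrix over a CM field -/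

namespace UnitaryGroup

open Literature.AlgebraicGeometry.ShimuraVarieties (hermForm)

variable (L : Type) [Field L] [NumberField L] [IsCMField L] (N : ℕ) (H : Matrix (Fin N) (Fin N) L)
  [MeasurableSpace (cmDatum L N H).Adelic] [BorelSpace (cmDatum L N H).Adelic]
  (μ : Measure (cmDatum L N H).automorphicQuotient) [(cmDatum L N H).IsAutomorphicMeasure μ]
  (ν : Measure (cmDatum L N H).Adelic) [ν.IsHaarMeasure] [ν.IsInvInvariant]

/-- **`θ_{G′}(g ⋆ h^*) = Σ_i ⟪R(h) e_i, R(g) e_i⟫`** for the inner form `G′ = U(H)`, `H` anisotropic: the named trace functional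
`UnitaryGroup.diagTrace L N H μ ν hanis` is the Hilbert–Schmidt pairing `Tr(R(g) R(h)^*)` on the whole convolution span `{g ⋆ h^*}`
(`AdelicGroupData.diagTrace_hasSum_inner` for the counting measure on the discrete `U(H)(L⁺)`). [cite: Rogawski1990, §14.5 p. 237]
[cite: Gelbart1975, (9.11) and Lemma 10.6] -/
theorem diagTrace_hasSum_inner (hanis : ∀ x : Fin N → L, hermForm (cmConjRingHom L) H x x = 0 → x = 0)
    (g h F : C_c((cmDatum L N H).Adelic, ℂ)) (hF : ∀ x, F x = mulConv ν (⇑g) (mulStar (⇑h)) x)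
    {ι : Type*} [Countable ι] (b : HilbertBasis ι ℂ ((cmDatum L N H).L2 μ)) :
    HasSum (fun i => ⟪((cmDatum L N H).rightRegular μ).integratedOperator ((cmDatum L N H).isUnitary_rightRegular μ)
        ((cmDatum L N H).isStronglyContinuous_rightRegular_holds μ) ν h (b i),
      ((cmDatum L N H).rightRegular μ).integratedOperator ((cmDatum L N H).isUnitary_rightRegular μ)
        ((cmDatum L N H).isStronglyContinuous_rightRegular_holds μ) ν g (b i)⟫_ℂ) (diagTrace L N H μ ν hanis F) := by
  haveI := compactSpace_cmDatum_automorphicQuotient L N H hanis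
  haveI := isClosed_cmDatum_quotientSubgroup L N H
  haveI := countable_cmDatum_quotientSubgroup L N H
  haveI := isFiniteMeasureOnCompacts_count_cmDatum_quotientSubgroup L N H
  exact AdelicGroupData.diagTrace_hasSum_inner (cmDatum L N H) μ Measure.count ν (NeZero.ne _) g h F hF b

end UnitaryGroup

end Literature.NumberTheory.Automorphic
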